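import Mathlib
import Literature.Probability.LatticeModels.Sweep1
import Literature.Probability.LatticeModels.ScalingLimit
import Literature.MathematicalPhysics.QuantumFieldTheory.MirrorRPKernel
import HarnessLib

/-!
# TwoPointSpineGlue (route PrecisionLaplacian, item stmt-CriticalPhenomena-4805) — lattice geometry

Helper file 1/4 for the conditional proof of
`Summit.CriticalPhenomena.Ising3DConformalLimit.Theses.PrecisionLaplacian.TwoPointSpineGlue`
(`PrecisionLaplacianTwoPointSpineGlue.lean`).  Pure geometry of `ℤ³ ⊂ ℝ³`:

* the embedding `siteVec : ℤ³ → ℝ³` (`Sweep1.lean`) and the coordinatewise-floor approximation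
  `latticeApprox N⁻¹ v = ⌊N v⌋` (`ScalingLimit.lean`): `‖⌊N v⌋ - N v‖ ≤ 2`, hence `⌊N v⌋/N → v`, the
  norms diverge and the directions converge (`tendsto_normalize_of_tendsto_inv_smul`);
* **directional transfer** (`tendsto_of_directional`, `tendsto_rpow_mul_of_directional`): an asymptotic
  `F x - K(x/‖x‖) → 0` along the cofinite filter of `ℤ³`, with `K` continuous on the unit sphere, gives
  `F (y_N) → K(w/‖w‖)` along every lattice sequence with `y_N / N → w ≠ 0` — the mechanism by which
  lattice identities (symmetry, reflection positivity) pass to a continuum limit kernel;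
* the nine lattice mirrors of `ℝ³` with normals `eᵢ`, `eᵢ ± eⱼ` (Mathlib's `((ℝ ∙ n)ᗮ).reflection`) in
  coordinates, the fact that they preserve `ℤ³` (acting as `xᵢ ↦ -xᵢ`, as `xᵢ ↦ -xⱼ, xⱼ ↦ -xᵢ` and as the
  swap), and that the normal coordinate of a lattice point is the integer `xᵢ`, `xᵢ + xⱼ`, `xᵢ - xⱼ` of
  the route's half-lattice conditions `ℓ > 0`.

No new definitions.  References: Fröhlich–Israel–Lieb–Simon 1978 §3 (site mirrors of `ℤ^d`).
-/

noncomputable section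

namespace Summit.CriticalPhenomena.Ising3DConformalLimit.Theorems.SpineGlue

open Filter Topology MeasureTheory
open Literature.Probability.LatticeModels Literature.Probability.Process
open Literature.MathematicalPhysics.QuantumFieldTheory
open scoped InnerProductSpace


/-! `siteVec : Site 3 → ℝ³` is the lattice embedding `x ↦ (x₀, x₁, x₂)` (`Sweep1.lean`);
`latticeApprox N⁻¹ v = ⌊N v⌋` (coordinatewise) is the lattice approximation (`ScalingLimit.lean`). -/

/-- The lattice embedding is additive: `vec (x - y) = vec x - vec y`. -/
theorem siteVec_sub (x y : Site 3) : siteVec (x - y) = siteVec x - siteVec y := by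
  ext i; simp [siteVec]

/-- The lattice embedding commutes with negation. -/
theorem siteVec_neg (x : Site 3) : siteVec (-x) = -siteVec x := by
  ext i; simp [siteVec]

/-- The origin of `ℤ³` embeds to the origin of `ℝ³`. -/
theorem siteVec_zero : siteVec (0 : Site 3) = 0 := by
  ext i; simp [siteVec]

/-- The Euclidean norm of an embedded lattice point is `√(∑ xᵢ²)` (the form used in the route statements). -/
theorem norm_siteVec (x : Site 3) : ‖siteVec x‖ = Real.sqrt (∑ i, ((x i : ℝ)) ^ 2) := by
  rw [EuclideanSpace.norm_eq]
  congr 1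
  refine Finset.sum_congr rfl fun i _ => ?_
  simp [siteVec, sq_abs]

/-- Only the origin embeds to `0`. -/
theorem siteVec_eq_zero_iff (x : Site 3) : siteVec x = 0 ↔ x = 0 := by
  constructor
  · intro h
    funext i
    have := congrArg (fun v : (EuclideanSpace ℝ (Fin 3)) => v i) h
    simpa [siteVec] using this
  · rintro rfl
    exact siteVec_zero

/-- The coordinatewise-floor approximation `⌊N v⌋` is within distance `2` of `N v`. -/
theorem norm_siteVec_latticeApprox_sub_le (N : ℕ) (v : (EuclideanSpace ℝ (Fin 3))) : ‖siteVec (latticeApprox ((N : ℝ)⁻¹) v) - (N : ℝ) • v‖ ≤ 2 := by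
  rw [EuclideanSpace.norm_eq]
  have h : ∀ i, ‖(siteVec (latticeApprox ((N : ℝ)⁻¹) v) - (N : ℝ) • v) i‖ ^ 2 ≤ 1 := by
    intro i
    simp only [PiLp.sub_apply, PiLp.smul_apply, siteVec_apply, latticeApprox_apply, div_inv_eq_mul,
      smul_eq_mul, Real.norm_eq_abs, sq_abs]
    have h1 := Int.floor_le (v i * (N : ℝ))
    have h2 := Int.lt_floor_add_one (v i * (N : ℝ))
    nlinarith
  calc Real.sqrt (∑ i, ‖(siteVec (latticeApprox ((N : ℝ)⁻¹) v) - (N : ℝ) • v) i‖ ^ 2)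
      ≤ Real.sqrt 4 := by
        apply Real.sqrt_le_sqrt
        calc ∑ i, ‖(siteVec (latticeApprox ((N : ℝ)⁻¹) v) - (N : ℝ) • v) i‖ ^ 2 ≤ ∑ _i : Fin 3, (1 : ℝ) :=
              Finset.sum_le_sum fun i _ => h i
          _ ≤ 4 := by norm_num
    _ = 2 := by
        rw [show (4 : ℝ) = 2 ^ 2 by norm_num, Real.sqrt_sq (by norm_num)]

/-- If `‖z N - N • w‖` stays bounded then `z N / N → w`. -/
theorem tendsto_inv_smul_of_norm_sub_le {z : ℕ → (EuclideanSpace ℝ (Fin 3))} {w : (EuclideanSpace ℝ (Fin 3))} {C : ℝ}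
    (h : ∀ N, ‖z N - (N : ℝ) • w‖ ≤ C) :
    Tendsto (fun N : ℕ => (N : ℝ)⁻¹ • z N) atTop (𝓝 w) := by
  rw [tendsto_iff_norm_sub_tendsto_zero]
  have hlim : Tendsto (fun N : ℕ => C * (N : ℝ)⁻¹) atTop (𝓝 0) := by
    simpa using tendsto_const_nhds.mul (tendsto_inv_atTop_nhds_zero_nat (𝕜 := ℝ))
  refine squeeze_zero' (Eventually.of_forall fun N => norm_nonneg _) ?_ hlim
  filter_upwards [eventually_ge_atTop 1] with N hN
  have hN0 : (N : ℝ) ≠ 0 := by exact_mod_cast (show N ≠ 0 by omega)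
  have : (N : ℝ)⁻¹ • z N - w = (N : ℝ)⁻¹ • (z N - (N : ℝ) • w) := by
    rw [smul_sub, smul_smul, inv_mul_cancel₀ hN0, one_smul]
  rw [this, norm_smul, norm_inv, Real.norm_natCast, mul_comm]
  exact mul_le_mul_of_nonneg_right (h N) (inv_nonneg.2 (Nat.cast_nonneg N))

/-- If `z N / N → w ≠ 0` then `‖z N‖ → ∞`. -/
theorem tendsto_norm_atTop_of_tendsto_inv_smul {z : ℕ → (EuclideanSpace ℝ (Fin 3))} {w : (EuclideanSpace ℝ (Fin 3))}
    (hz : Tendsto (fun N : ℕ => (N : ℝ)⁻¹ • z N) atTop (𝓝 w)) (hw : w ≠ 0) :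
    Tendsto (fun N => ‖z N‖) atTop atTop := by
  have hwpos : 0 < ‖w‖ / 2 := half_pos (norm_pos_iff.2 hw)
  have h1 : Tendsto (fun N : ℕ => ‖(N : ℝ)⁻¹ • z N‖) atTop (𝓝 ‖w‖) := hz.norm
  have h2 : ∀ᶠ N : ℕ in atTop, ‖w‖ / 2 ≤ ‖(N : ℝ)⁻¹ • z N‖ :=
    h1.eventually (eventually_ge_nhds (half_lt_self (norm_pos_iff.2 hw)))
  have h3 : Tendsto (fun N : ℕ => (N : ℝ) * (‖w‖ / 2)) atTop atTop :=
    tendsto_natCast_atTop_atTop.atTop_mul_const hwpos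
  refine tendsto_atTop_mono' atTop ?_ h3
  filter_upwards [h2, eventually_ge_atTop 1] with N hN hN1
  have hNpos : (0 : ℝ) < N := by exact_mod_cast hN1
  rw [norm_smul, norm_inv, Real.norm_natCast] at hN
  calc (N : ℝ) * (‖w‖ / 2) ≤ N * ((N : ℝ)⁻¹ * ‖z N‖) := by gcongr
    _ = ‖z N‖ := by field_simp

/-- If `z N / N → w ≠ 0` then the directions converge: `z N / ‖z N‖ → w / ‖w‖`. -/
theorem tendsto_normalize_of_tendsto_inv_smul {z : ℕ → (EuclideanSpace ℝ (Fin 3))} {w : (EuclideanSpace ℝ (Fin 3))}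
    (hz : Tendsto (fun N : ℕ => (N : ℝ)⁻¹ • z N) atTop (𝓝 w)) (hw : w ≠ 0) :
    Tendsto (fun N => ‖z N‖⁻¹ • z N) atTop (𝓝 (‖w‖⁻¹ • w)) := by
  have hcont : ContinuousAt (fun u : (EuclideanSpace ℝ (Fin 3)) => ‖u‖⁻¹ • u) w :=
    ((continuousAt_id.norm).inv₀ (norm_ne_zero_iff.2 hw)).smul continuousAt_id
  have h := hcont.tendsto.comp hz
  refine h.congr' ?_
  filter_upwards [eventually_ge_atTop 1] with N hN
  have hN0 : (N : ℝ) ≠ 0 := by exact_mod_cast (show N ≠ 0 by omega)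
  simp only [Function.comp_apply]
  rw [norm_smul, norm_inv, Real.norm_natCast, smul_smul]
  congr 1
  rw [mul_inv, inv_inv, mul_assoc, mul_comm ‖z N‖⁻¹, ← mul_assoc, mul_inv_cancel₀ hN0, one_mul]

/-- A lattice sequence whose embedding grows without bound leaves every finite set. -/
theorem tendsto_cofinite_of_norm_siteVec {y : ℕ → Site 3}
    (hy : Tendsto (fun N => ‖siteVec (y N)‖) atTop atTop) : Tendsto y atTop cofinite := by
  intro s hs
  have hfin : Set.Finite sᶜ := hs
  obtain ⟨M, hM⟩ : ∃ M : ℝ, ∀ x ∈ sᶜ, ‖siteVec x‖ ≤ M := by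
    obtain ⟨M, hM⟩ := (hfin.image fun x => ‖siteVec x‖).bddAbove
    exact ⟨M, fun x hx => hM (Set.mem_image_of_mem _ hx)⟩
  have h := hy.eventually_gt_atTop M
  rw [Filter.mem_map]
  filter_upwards [h] with N hN
  by_contra hc
  exact absurd (hM _ hc) (not_le.2 hN)

/-- **Directional transfer.** If `F x - K(x̂) → 0` at infinity on the lattice and `K` is continuous on
the unit sphere, then along any lattice sequence `y N` with `y N / N → w ≠ 0`, `F (y N) → K (ŵ)`. -/
theorem tendsto_of_directional {F : Site 3 → ℝ} {K : (EuclideanSpace ℝ (Fin 3)) → ℝ}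
    (hF : Tendsto (fun x => F x - K (‖siteVec x‖⁻¹ • siteVec x)) cofinite (𝓝 0))
    (hK : ContinuousOn K (Metric.sphere 0 1))
    {y : ℕ → Site 3} {w : (EuclideanSpace ℝ (Fin 3))} (hy : Tendsto (fun N : ℕ => (N : ℝ)⁻¹ • siteVec (y N)) atTop (𝓝 w))
    (hw : w ≠ 0) :
    Tendsto (fun N => F (y N)) atTop (𝓝 (K (‖w‖⁻¹ • w))) := by
  have hnorm := tendsto_norm_atTop_of_tendsto_inv_smul hy hw
  have hcof : Tendsto y atTop cofinite := tendsto_cofinite_of_norm_siteVec hnorm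
  have h1 : Tendsto (fun N => F (y N) - K (‖siteVec (y N)‖⁻¹ • siteVec (y N))) atTop (𝓝 0) :=
    hF.comp hcof
  have h2 : Tendsto (fun N => K (‖siteVec (y N)‖⁻¹ • siteVec (y N))) atTop (𝓝 (K (‖w‖⁻¹ • w))) := by
    have hmem : ‖w‖⁻¹ • w ∈ Metric.sphere (0 : (EuclideanSpace ℝ (Fin 3))) 1 := by
      simp [norm_smul, hw]
    have hc := (hK _ hmem).tendsto
    refine hc.comp (tendsto_nhdsWithin_iff.2 ⟨tendsto_normalize_of_tendsto_inv_smul hy hw, ?_⟩)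
    filter_upwards [hnorm.eventually_gt_atTop 0] with N hN
    simp [norm_smul, hN.ne']
  have := h1.add h2
  simpa using this

/-- The scaled form: if `F x ‖x‖^s - K(x̂) → 0` then `N^s F (y N) → ‖w‖^{-s} K(ŵ)`. -/
theorem tendsto_rpow_mul_of_directional {F : Site 3 → ℝ} {K : (EuclideanSpace ℝ (Fin 3)) → ℝ} {s : ℝ}
    (hF : Tendsto (fun x => F x * ‖siteVec x‖ ^ s - K (‖siteVec x‖⁻¹ • siteVec x)) cofinite (𝓝 0))
    (hK : ContinuousOn K (Metric.sphere 0 1))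
    {y : ℕ → Site 3} {w : (EuclideanSpace ℝ (Fin 3))} (hy : Tendsto (fun N : ℕ => (N : ℝ)⁻¹ • siteVec (y N)) atTop (𝓝 w))
    (hw : w ≠ 0) :
    Tendsto (fun N : ℕ => (N : ℝ) ^ s * F (y N)) atTop (𝓝 (‖w‖ ^ (-s) * K (‖w‖⁻¹ • w))) := by
  have h1 := tendsto_of_directional (F := fun x => F x * ‖siteVec x‖ ^ s) hF hK hy hw
  have hw' : ‖w‖ ≠ 0 := norm_ne_zero_iff.2 hw
  have h2 : Tendsto (fun N : ℕ => ((N : ℝ)⁻¹ * ‖siteVec (y N)‖)⁻¹) atTop (𝓝 ‖w‖⁻¹) := by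
    have h := hy.norm
    simp_rw [norm_smul, norm_inv, Real.norm_natCast] at h
    exact h.inv₀ hw'
  have h3 : Tendsto (fun N : ℕ => ((N : ℝ)⁻¹ * ‖siteVec (y N)‖)⁻¹ ^ s) atTop (𝓝 (‖w‖⁻¹ ^ s)) :=
    h2.rpow_const (Or.inl (inv_ne_zero hw'))
  have h4 := h3.mul h1
  have hnorm := tendsto_norm_atTop_of_tendsto_inv_smul hy hw
  have hval : ‖w‖⁻¹ ^ s * K (‖w‖⁻¹ • w) = ‖w‖ ^ (-s) * K (‖w‖⁻¹ • w) := by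
    rw [Real.inv_rpow (norm_nonneg _), Real.rpow_neg (norm_nonneg _)]
  rw [← hval]
  refine h4.congr' ?_
  filter_upwards [hnorm.eventually_gt_atTop 0, eventually_ge_atTop 1] with N hN hN1
  have hNpos : (0 : ℝ) < N := by exact_mod_cast hN1
  rw [mul_inv, inv_inv, Real.mul_rpow hNpos.le (inv_nonneg.2 hN.le),
    Real.inv_rpow hN.le]
  field_simp

/-! ### Coordinates of the mirror normals -/

/-- `⟪v, eᵢ⟫ = vᵢ`. -/
theorem inner_single_one (v : (EuclideanSpace ℝ (Fin 3))) (i : Fin 3) :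
    ⟪v, EuclideanSpace.single i (1 : ℝ)⟫_ℝ = v i := by
  rw [EuclideanSpace.inner_single_right]; simp

/-- `‖eᵢ‖ = 1`. -/
theorem norm_single_one (i : Fin 3) : ‖(EuclideanSpace.single i (1 : ℝ) : (EuclideanSpace ℝ (Fin 3)))‖ = 1 := by
  rw [PiLp.norm_single, norm_one]

/-- `⟪v, eᵢ + eⱼ⟫ = vᵢ + vⱼ`. -/
theorem inner_single_add (v : (EuclideanSpace ℝ (Fin 3))) (i j : Fin 3) :
    ⟪v, EuclideanSpace.single i (1 : ℝ) + EuclideanSpace.single j (1 : ℝ)⟫_ℝ = v i + v j := by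
  rw [inner_add_right, inner_single_one, inner_single_one]

/-- `⟪v, eᵢ - eⱼ⟫ = vᵢ - vⱼ`. -/
theorem inner_single_sub (v : (EuclideanSpace ℝ (Fin 3))) (i j : Fin 3) :
    ⟪v, EuclideanSpace.single i (1 : ℝ) - EuclideanSpace.single j (1 : ℝ)⟫_ℝ = v i - v j := by
  rw [inner_sub_right, inner_single_one, inner_single_one]

/-- `‖eᵢ + eⱼ‖² = 2` for `i ≠ j`. -/
theorem norm_sq_single_add {i j : Fin 3} (hij : i ≠ j) :
    ‖(EuclideanSpace.single i (1 : ℝ) + EuclideanSpace.single j (1 : ℝ) : (EuclideanSpace ℝ (Fin 3)))‖ ^ 2 = 2 := by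
  rw [← real_inner_self_eq_norm_sq, inner_single_add]
  simp [hij, Ne.symm hij]
  norm_num

/-- `‖eᵢ - eⱼ‖² = 2` for `i ≠ j`. -/
theorem norm_sq_single_sub {i j : Fin 3} (hij : i ≠ j) :
    ‖(EuclideanSpace.single i (1 : ℝ) - EuclideanSpace.single j (1 : ℝ) : (EuclideanSpace ℝ (Fin 3)))‖ ^ 2 = 2 := by
  rw [← real_inner_self_eq_norm_sq, inner_single_sub]
  simp [hij, Ne.symm hij]
  norm_num

/-! ### The three mirror reflections in coordinates -/

/-- The coordinate mirror `θ_{eᵢ}` negates the `i`-th coordinate. -/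
theorem reflection_single_apply (i : Fin 3) (v : (EuclideanSpace ℝ (Fin 3))) (k : Fin 3) :
    (ℝ ∙ (EuclideanSpace.single i (1 : ℝ) : (EuclideanSpace ℝ (Fin 3))))ᗮ.reflection v k =
      if k = i then -v k else v k := by
  rw [mirrorReflection_apply, inner_single_one, norm_single_one]
  simp only [one_pow, div_one, PiLp.sub_apply, PiLp.smul_apply, PiLp.single_apply,
    smul_eq_mul, mul_ite, mul_one, mul_zero]
  split_ifs with h
  · subst h; ring
  · ring

/-- The anti-diagonal mirror `θ_{eᵢ+eⱼ}`: `xᵢ ↦ -xⱼ`, `xⱼ ↦ -xᵢ`. -/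
theorem reflection_single_add_apply {i j : Fin 3} (hij : i ≠ j) (v : (EuclideanSpace ℝ (Fin 3))) (k : Fin 3) :
    (ℝ ∙ (EuclideanSpace.single i (1 : ℝ) + EuclideanSpace.single j (1 : ℝ) : (EuclideanSpace ℝ (Fin 3))))ᗮ.reflection v k =
      if k = i then -v j else if k = j then -v i else v k := by
  rw [mirrorReflection_apply, inner_single_add, norm_sq_single_add hij]
  simp only [PiLp.sub_apply, PiLp.smul_apply, PiLp.add_apply, PiLp.single_apply,
    smul_eq_mul]
  by_cases hk : k = i
  · subst hk; simp [hij]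
  · by_cases hk' : k = j
    · subst hk'; simp [hk]
    · simp [hk, hk']

/-- The diagonal mirror `θ_{eᵢ-eⱼ}` swaps the coordinates `i` and `j`. -/
theorem reflection_single_sub_apply {i j : Fin 3} (hij : i ≠ j) (v : (EuclideanSpace ℝ (Fin 3))) (k : Fin 3) :
    (ℝ ∙ (EuclideanSpace.single i (1 : ℝ) - EuclideanSpace.single j (1 : ℝ) : (EuclideanSpace ℝ (Fin 3))))ᗮ.reflection v k =
      if k = i then v j else if k = j then v i else v k := by
  rw [mirrorReflection_apply, inner_single_sub, norm_sq_single_sub hij]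
  simp only [PiLp.sub_apply, PiLp.smul_apply, PiLp.single_apply, smul_eq_mul]
  by_cases hk : k = i
  · subst hk; simp [hij]
  · by_cases hk' : k = j
    · subst hk'; simp [hk]
    · simp [hk, hk']

/-! ### They preserve the lattice: `θ (siteVec x) = siteVec (θ_ℤ x)` -/

/-- `θ_{eᵢ}` preserves the lattice: it is `x ↦ update x i (-x i)` on `ℤ³`. -/
theorem reflection_single_vec (i : Fin 3) (x : Site 3) :
    (ℝ ∙ (EuclideanSpace.single i (1 : ℝ) : (EuclideanSpace ℝ (Fin 3))))ᗮ.reflection (siteVec x) =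
      siteVec (Function.update x i (-x i)) := by
  ext k
  rw [reflection_single_apply]
  by_cases hk : k = i
  · subst hk; simp
  · simp [hk]

/-- `θ_{eᵢ+eⱼ}` preserves the lattice: it is `x ↦ update (update x i (-x j)) j (-x i)` on `ℤ³`. -/
theorem reflection_single_add_vec {i j : Fin 3} (hij : i ≠ j) (x : Site 3) :
    (ℝ ∙ (EuclideanSpace.single i (1 : ℝ) + EuclideanSpace.single j (1 : ℝ) : (EuclideanSpace ℝ (Fin 3))))ᗮ.reflection (siteVec x)
      = siteVec (Function.update (Function.update x i (-x j)) j (-x i)) := by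
  ext k
  rw [reflection_single_add_apply hij]
  by_cases hk : k = i
  · subst hk; simp [hij]
  · by_cases hk' : k = j
    · subst hk'; simp [hk]
    · simp [hk, hk']

/-- `θ_{eᵢ-eⱼ}` preserves the lattice: it is `x ↦ x ∘ swap i j` on `ℤ³`. -/
theorem reflection_single_sub_vec {i j : Fin 3} (hij : i ≠ j) (x : Site 3) :
    (ℝ ∙ (EuclideanSpace.single i (1 : ℝ) - EuclideanSpace.single j (1 : ℝ) : (EuclideanSpace ℝ (Fin 3))))ᗮ.reflection (siteVec x)
      = siteVec (x ∘ Equiv.swap i j) := by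
  ext k
  rw [reflection_single_sub_apply hij]
  by_cases hk : k = i
  · subst hk; simp
  · by_cases hk' : k = j
    · subst hk'; simp [hk]
    · simp [hk, hk', Equiv.swap_apply_of_ne_of_ne]

/-! ### The normal coordinate of a lattice point is the integer `ℓ x` -/

/-- The normal coordinate of a lattice point for the mirror `eᵢ` is the integer `xᵢ`. -/
theorem inner_vec_single (i : Fin 3) (x : Site 3) :
    ⟪siteVec x, EuclideanSpace.single i (1 : ℝ)⟫_ℝ = ((x i : ℤ) : ℝ) := by
  rw [inner_single_one]; rfl

/-- The normal coordinate of a lattice point for the mirror `eᵢ + eⱼ` is the integer `xᵢ + xⱼ`. -/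
theorem inner_vec_single_add (i j : Fin 3) (x : Site 3) :
    ⟪siteVec x, EuclideanSpace.single i (1 : ℝ) + EuclideanSpace.single j (1 : ℝ)⟫_ℝ =
      ((x i + x j : ℤ) : ℝ) := by
  rw [inner_single_add]; push_cast; rfl

/-- The normal coordinate of a lattice point for the mirror `eᵢ - eⱼ` is the integer `xᵢ - xⱼ`. -/
theorem inner_vec_single_sub (i j : Fin 3) (x : Site 3) :
    ⟪siteVec x, EuclideanSpace.single i (1 : ℝ) - EuclideanSpace.single j (1 : ℝ)⟫_ℝ =
      ((x i - x j : ℤ) : ℝ) := by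
  rw [inner_single_sub]; push_cast; rfl

end Summit.CriticalPhenomena.Ising3DConformalLimit.Theorems.SpineGlue
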